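import Mathlib
import Literature.Analysis.ODE.CodeListMeanValueExtension
import Summits.Ventures.FusionMHD.Models.CerfonFreidbergIterLikeAxis
import Summits.Ventures.FusionMHD.Models.FluxSurfacePolarRay
import HarnessLib

/-!
# F1-CF.Q-POLAR-SIZING — ONE θ-panel of a polar-ray certificate for `q/F(ψ_N = 1/2)` on the Cerfon–Freidberg ITER-like flux of
# record: the ray-root bracket `ρ(θ) ∈ (0.19784, 0.201872)` and the radial-derivative bracket on the panel `θ ∈ [0, 1/40]`,
# by mean-value-extension range certificates over #34's KERNEL coefficient box — a SIZING DATUM (kernel seconds per panel), not a q certificate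

LADDER-GRIDFUSION (F1-CF / F2 item R2; lead g6 RULING 6y «F1-CF.Q-POLAR-SIZING» GO on model-7 OFFER 3), cell `gridfusion`, seat
`gridfusion-model-7` (g2), 2026-08-27.  A SIZED-ASK §5 MEASURED CELL — «sizing datum for a priced wave-1 item», NOT a ★ row, NOT a `q`
certificate.  WHAT IS MEASURED: the elementary step that a certified `q`-PROFILE (or any `∮ g dl/(R²B_p)` functional) on a SHAPED analytic
equilibrium needs, via the polar-ray reduction `Models/FluxSurfacePolarRay.lean` (#88; `dl/|∇ψ| = (ρ/|D_r|) dθ`, the exact all-surface form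
of Freidberg's on-axis cancellation §6.3.6): per θ-panel, (a) the ray root `ρ(θ)` of `U(X_a + ρ cos θ, ρ sin θ) = u`, `u = (1 − ψ_N)·U(X_a, 0)`,
is BRACKETED by a sign change plus `∂_ρ > 0` (PolarRay §3), (b) the integrand `ρ/(X·D_r)` is then enclosed from the brackets (not done
here).  Inputs BY NAME: `CFIterLike.axKrawczyk.box` / `axZero` / `coeff` / `U` / `Xa` / `U_axis` (gridfusion-model-5, p504960 / p505941:
18-coordinate kernel box centre ± 2⁻³⁰; coordinates 0–6 = `c`, 8 = `X_a`, 17 = `U(X_a, 0)`); the natural-extension / MEAN-VALUE range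
certificates `evalBoxLE` / `mvExtLE` of `Literature/Analysis/ODE/CodeListMeanValueExtension.lean` (Moore 1966 Thm 3.1 / Moore 1979 (4.19);
soundness `eval_mem_of_evalBoxLE` / `eval_mem_of_mvExtLE`; `hasDerivAt_eval_update` for the derived code list (4.21)).  ONE code list `G` in
ELEVEN variables (0–6 = `c`, 7 = `X_a`, 8 = `U(X_a,0)`, 9 = `θ`, 10 = `ρ`) with ONE symbolic identity (`eval_gExpr`); the radial derivative is
the DERIVED code list `gExpr.pderiv 10` (no hand-written `U_X`, `U_Y`).
THREE COLUMNS.  CERTIFIED (kernel, this file): for THE flux of record `U` and axis `X_a` of the CF ITER-like instance, on the panel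
`θ ∈ [0, 1/40]` (≈ `2π/251`; outboard midplane side): `U(X_a + ρ cos θ, ρ sin θ) < U(X_a,0)/2` at `ρ = 0.19784` and `> U(X_a,0)/2` at
`ρ = 0.201872` (`G_lo_neg`, `G_hi_pos`); `0.176753 ≤ ∂_ρ U(X_a + ρ cos θ, ρ sin θ) ≤ 0.221503` for `ρ ∈ [0.19784, 0.201872]`
(`hasDerivAt_rayProfile`); hence **on every ray of the panel the surface `ψ_N = 1/2` (`U = U(X_a,0)/2`) is met EXACTLY ONCE with
`ρ(θ) ∈ [0.19784, 0.201872]`** (`existsUnique_root`) — the first kernel statement about an INTERIOR flux surface of the shaped CF equilibrium,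
deliberately tiny.  MEASURED (the datum): the four `decide +kernel` certificates elaborate in ≈ 25 s on the farm (whole file ≈ 32 s; each
mean-value certificate over the 11-variable box ≈ 5–8 s, the derivative one ≈ 10 s); companion measurements (not filed; generator
`cert/model-7/gen_panel.py θ₀ θ₁ margin`): the same panel width at the TOP of the surface (`θ ∈ [3/2, 3/2 + 1/40]`, `ρ ≈ 0.336`, `ρ′ ≈ 0.17`)
FAILS with bracket margin 0.002 (mean-value excess) and PASSES with margin 0.004 (27 s) or with half the width (27 s); a 4× wider panel
(`[0, 1/10]`) FAILS — so ≈ 250 panels of width ≈ 1/40 cover a surface, ≈ 25 s each ⇒ ≈ 105 farm-minutes ≈ 45–50 files of ≤ 150 s for ONE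
surface's root brackets (relative width ±1–2 %), before the (cheap) integrand sums.  VALIDATED (float; generator and `cert/model-7/polar_q_check.py`):
`ρ(θ) ∈ [0.199840, 0.199872]` on the panel; `q/F(1/2) = 2.4076383` (two float lineages, model-5 B3/B4 and model-7, agree to 3e-11).
MODELLED: analytic Cerfon–Freidberg family (α = 0), shape triple of record.  NOT CLAIMED: any value of `q`; that the whole surface is
star-shaped about the axis; anything about a device.  No `native_decide`; `decide +kernel` only in the four certificates.
-/

noncomputable section

open Set NonemptyInterval
open Literature.Analysis.ODE Literature.Analysis.ODE.FExpr
open Literature.Analysis.ValidatedNumerics Literature.Analysis.ValidatedNumerics.ITaylor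
open Literature.MathematicalPhysics.MHD Literature.MathematicalPhysics.MHD.CerfonFreidberg _root_.Real

namespace Summit.Ventures.FusionMHD.Models.CFIterLike

namespace PolarPanel

/-! ## §1 The code list of `G(c, X_a, U_a, θ, ρ) = U(X_a + ρ cos θ, ρ sin θ; c) − (1 − ψ_N)·U_a` and its reading -/

/-- The code list of `G` for `ψ_N = 1/2` (11 variables; `U = cfSolution 0 c`, (6.153), written out). [instance data] -/
def gExpr : FExpr 11 :=
  sub (add (add (add (add (add (add (add (smul (1/8) (pow (add (var 7) (mul (var 10) (cos (var 9)))) 4)) (var 0)) (mul (var 1) (pow (add (var 7) (mul (var 10) (cos (var 9)))) 2))) (mul (var 2) (sub (pow (mul (var 10) (sin (var 9))) 2) (mul (pow (add (var 7) (mul (var 10) (cos (var 9)))) 2) (log (add (var 7) (mul (var 10) (cos (var 9))))))))) (mul (var 3) (sub (pow (add (var 7) (mul (var 10) (cos (var 9)))) 4) (smul 4 (mul (pow (add (var 7) (mul (var 10) (cos (var 9)))) 2) (pow (mul (var 10) (sin (var 9))) 2)))))) (mul (var 4) (sub (sub (smul 2 (pow (mul (var 10) (sin (var 9))) 4)) (smul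 9 (mul (pow (mul (var 10) (sin (var 9))) 2) (pow (add (var 7) (mul (var 10) (cos (var 9)))) 2)))) (mul (sub (smul 12 (mul (pow (mul (var 10) (sin (var 9))) 2) (pow (add (var 7) (mul (var 10) (cos (var 9)))) 2))) (smul 3 (pow (add (var 7) (mul (var 10) (cos (var 9)))) 4))) (log (add (var 7) (mul (var 10) (cos (var 9))))))))) (mul (var 5) (add (sub (pow (add (var 7) (mul (var 10) (cos (var 9)))) 6) (smul 12 (mul (pow (add (var 7) (mul (var 10) (cos (var 9)))) 4) (pow (mul (var 10) (sin (var 9))) 2)))) (smul 8 (mul (pow (add (var 7) (mul (var 10) (cos (var 9)))) 2) (pow (mul (var 10) (sin (var 9))) 4)))))) (mul (var 6) (sub (add (sub (smul 8 (pow (mul (var 10) (sin (var 9))) 6)) (smul 140 (mul (pow (mul (var 10) (sin (var 9))) 4) (pow (add (var 7) (mul (var 10) (cos (var 9)))) 2)))) (smul 75 (mul (pow (mul (var 10) (sin (var 9))) 2) (pow (add (var 7) (mul (var 10) (cos (var 9)))) 4)))) (mul (add (sub (smul 120 (mul (pow (mul (var 10) (sin (var 9))) 4) (pow (add (var 7)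 (mul (var 10) (cos (var 9)))) 2))) (smul 180 (mul (pow (mul (var 10) (sin (var 9))) 2) (pow (add (var 7) (mul (var 10) (cos (var 9)))) 4)))) (smul 15 (pow (add (var 7) (mul (var 10) (cos (var 9)))) 6))) (log (add (var 7) (mul (var 10) (cos (var 9))))))))) (smul (1/2) (var 8))

/-- The coefficient vector carried by a point of the 11-variable space. [instance data] -/
def cOf (y : Fin 11 → ℝ) : Fin 7 → ℝ := ![y 0, y 1, y 2, y 3, y 4, y 5, y 6]

/-- READING: the code list evaluates to `U(X_a + ρ cos θ, ρ sin θ; c) − (1 − ψ_N) U_a`. [instance data] -/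
theorem eval_gExpr (y : Fin 11 → ℝ) :
    gExpr.eval y = cfSolution 0 (cOf y) (y 7 + y 10 * Real.cos (y 9)) (y 10 * Real.sin (y 9)) - ((1 / 2) : ℝ) * y 8 := by
  simp [gExpr, FExpr.eval, cfSolution, UP, U0, U1, U2, U3, U4, U5, U6, cOf]
  ring

/-- The radial derivative code list `∂G/∂ρ` (Moore (4.21), line by line). [instance data] -/
def dExpr : FExpr 11 := gExpr.pderiv 10

/-! ## §2 The boxes: kernel coefficient box × panel × radius -/

/-- The θ-panel `[0, 1/40]`. [instance data] -/
def panel : Iv := ⟨(0, (1 / 40)), by decide +kernel⟩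

/-- The box at fixed radius `r`: coordinates 0–6 and 7, 8 = the kernel box (c, X_a, U(X_a,0)), 9 = the panel, 10 = `[r, r]`. [instance data] -/
def boxAt (r : Iv) : Fin 11 → Iv := fun i =>
  if h : (i : ℕ) < 7 then axKrawczyk.box ⟨i, by omega⟩
  else if (i : ℕ) = 7 then axKrawczyk.box 8
  else if (i : ℕ) = 8 then axKrawczyk.box 17
  else if (i : ℕ) = 9 then panel else r

/-- Lower radius `ρ_lo = 0.19784`. [instance data] -/
def rLo : Iv := ⟨((2473 / 12500), (2473 / 12500)), by decide +kernel⟩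
/-- Upper radius `ρ_hi = 0.201872`. [instance data] -/
def rHi : Iv := ⟨((12617 / 62500), (12617 / 62500)), by decide +kernel⟩
/-- The radius bracket `[ρ_lo, ρ_hi]`. [instance data] -/
def rSeg : Iv := ⟨((2473 / 12500), (12617 / 62500)), by decide +kernel⟩

/-- Rational centres for the mean value extension. [instance data] -/
def ctr (r : ℚ) : Fin 11 → ℚ := fun i =>
  if h : (i : ℕ) < 7 then axKrawczyk.center ⟨i, by omega⟩
  else if (i : ℕ) = 7 then axKrawczyk.center 8
  else if (i : ℕ) = 8 then axKrawczyk.center 17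
  else if (i : ℕ) = 9 then (1 / 80) else r

/-! ## §3 THE THREE RANGE CERTIFICATES (kernel, `decide +kernel`; the SIZING DATUM is their elaboration time) -/

/-- (a) `G(ρ_lo) ≤ -1.310e-04 < 0` on the panel (mean value extension). [instance data] -/
theorem cert_lo : mvExtLE ⟨64, 60, 56, 4, 0⟩ gExpr (boxAt rLo) (ctr (2473 / 12500)) ⟨(-1, (-131 / 1000000)), by decide +kernel⟩ = true := by
  decide +kernel

/-- (b) `G(ρ_hi) ≥ 1.330e-04 > 0` on the panel (mean value extension). [instance data] -/
theorem cert_hi : mvExtLE ⟨64, 60, 56, 4, 0⟩ gExpr (boxAt rHi) (ctr (12617 / 62500)) ⟨((133 / 1000000), 1), by decide +kernel⟩ = true := by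
  decide +kernel

/-- (c) `∂G/∂ρ ∈ [0.176753, 0.221503]` on the panel × the radius bracket (mean value extension). [instance data] -/
theorem cert_dr : mvExtLE ⟨64, 60, 56, 4, 0⟩ dExpr (boxAt rSeg) (ctr (12491 / 62500)) ⟨((176753 / 1000000), (221503 / 1000000)), by decide +kernel⟩ = true := by
  decide +kernel

/-- (d) DOMAIN certificate: the natural extension of `G` over the panel × radius-bracket box exists (certifies `ln X` etc. are
defined there; needed for the derivative reading). [instance data] -/
theorem cert_dom : evalBoxLE ⟨64, 60, 56, 4, 0⟩ gExpr (boxAt rSeg) ⟨(-1, 1), by decide +kernel⟩ = true := by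
  decide +kernel

/-! ## §4 KERNEL FACTS at the instance of record: sign change, radial-derivative bracket, unique ray root on the panel -/

/-- The point of the 11-space carrying THE instance: `(coeff, X_a, U(X_a,0), θ, ρ)`. [instance data] -/
def pt (θ ρ : ℝ) : Fin 11 → ℝ := fun i =>
  if h : (i : ℕ) < 7 then axZero ⟨i, by omega⟩
  else if (i : ℕ) = 7 then axZero 8
  else if (i : ℕ) = 8 then axZero 17
  else if (i : ℕ) = 9 then θ else ρ

/-- Its coefficient part is `coeff`. [instance data] -/
theorem cOf_pt (θ ρ : ℝ) : cOf (pt θ ρ) = coeff := by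
  funext k
  fin_cases k <;> simp [cOf, pt, coeff, axCoeffs, axProj, coeffs]

/-- From a natural-extension range certificate, every point of the box lies in the code list's natural domain. [folklore] -/
theorem dom_of_evalBoxLE {m : ℕ} {cfg : SeedCfg} {e : FExpr m} {X : Fin m → Iv} {I : Iv} (h : evalBoxLE cfg e X I = true)
    {y : Fin m → ℝ} (hy : y ∈ boxSet (castBox X)) : e.dom y := by
  unfold evalBoxLE at h
  cases hJ : evalBox cfg e X with
  | none => simp [hJ] at h
  | some J => exact (evalBox_sound hJ hy).1

/-- `pt θ ρ` lies in `boxAt r` whenever `θ` is in the panel and `ρ ∈ r`. [instance data] -/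
theorem pt_mem {θ ρ : ℝ} {r : Iv} (hθ : ((panel.fst : ℚ) : ℝ) ≤ θ ∧ θ ≤ ((panel.snd : ℚ) : ℝ))
    (hρ : ((r.fst : ℚ) : ℝ) ≤ ρ ∧ ρ ≤ ((r.snd : ℚ) : ℝ)) : pt θ ρ ∈ boxSet (castBox (boxAt r)) := by
  have hz := mem_boxSet_iff.mp axZero_mem
  rw [mem_boxSet_iff]
  intro i
  rw [castBox_apply, mem_ratCast_iff]
  by_cases hi : (i : ℕ) < 7
  · have h := hz ⟨i, by omega⟩
    rw [castBox_apply, mem_ratCast_iff] at h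
    simp only [boxAt, pt, hi, dif_pos]
    exact h
  · by_cases h7 : (i : ℕ) = 7
    · have h := hz 8
      rw [castBox_apply, mem_ratCast_iff] at h
      simp only [boxAt, pt, h7, if_true]
      exact h
    · by_cases h8 : (i : ℕ) = 8
      · have h := hz 17
        rw [castBox_apply, mem_ratCast_iff] at h
        simp only [boxAt, pt, h8, if_true]
        exact h
      · by_cases h9 : (i : ℕ) = 9
        · simp only [boxAt, pt, h9, if_true]
          exact hθ
        · simp only [boxAt, pt, hi, h7, h8, h9, dif_neg, not_false_eq_true, if_false]
          exact hρ

/-- READING at the instance: `G(pt θ ρ) = U(X_a + ρ cos θ, ρ sin θ) − (1 − ψ_N)·U(X_a, 0)` for THE flux `U` of record. [instance data] -/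
theorem eval_pt (θ ρ : ℝ) :
    gExpr.eval (pt θ ρ) = U (Xa + ρ * Real.cos θ) (ρ * Real.sin θ) - ((1 / 2) : ℝ) * U Xa 0 := by
  rw [eval_gExpr, cOf_pt, U_axis]
  rfl

/-- The ray profile of `U` about the axis is `G + (1 − ψ_N)U(X_a,0)` along `ρ`. [instance data] -/
theorem rayProfile_eq (θ ρ : ℝ) :
    PolarRay.rayProfile U Xa 0 θ ρ = gExpr.eval (pt θ ρ) + ((1 / 2) : ℝ) * U Xa 0 := by
  rw [eval_pt]
  unfold PolarRay.rayProfile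
  rw [zero_add]
  ring

/-- Updating the radius coordinate of `pt θ s` gives `pt θ r`. [instance data] -/
theorem update_pt (θ s r : ℝ) : Function.update (pt θ s) 10 r = pt θ r := by
  funext i
  fin_cases i <;> simp [pt, Function.update]

/-- The panel endpoints and radii (decided rationals). [instance data] -/
theorem panel_eq : panel.fst = 0 ∧ panel.snd = (1 / 40) ∧ rLo.fst = (2473 / 12500) ∧ rLo.snd = (2473 / 12500)
    ∧ rHi.fst = (12617 / 62500) ∧ rHi.snd = (12617 / 62500) ∧ rSeg.fst = (2473 / 12500) ∧ rSeg.snd = (12617 / 62500) := by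
  unfold panel rLo rHi rSeg
  exact ⟨rfl, rfl, rfl, rfl, rfl, rfl, rfl, rfl⟩

/-- **KERNEL FACT (a): below the bracket the flux is BELOW the level** — for every `θ` in the panel,
`U(X_a + ρ_lo cos θ, ρ_lo sin θ) < (1 − ψ_N)U(X_a,0)` (certified margin `-1.31e-04`). [instance data] -/
theorem G_lo_neg {θ : ℝ} (h0 : (0 : ℝ) ≤ θ) (h1 : θ ≤ (1 / 40)) :
    PolarRay.rayProfile U Xa 0 θ ((2473 / 12500)) < ((1 / 2) : ℝ) * U Xa 0 := by
  obtain ⟨e0, e1, e2, e3, -, -, -, -⟩ := panel_eq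
  have hmem : pt θ ((2473 / 12500)) ∈ boxSet (castBox (boxAt rLo)) :=
    pt_mem ⟨by rw [e0]; push_cast; linarith, by rw [e1]; push_cast; linarith⟩ ⟨by rw [e2]; push_cast; linarith, by rw [e3]; push_cast; linarith⟩
  have h := eval_mem_of_mvExtLE cert_lo hmem
  rw [mem_ratCast_iff] at h
  have h2 := h.2
  push_cast at h2
  rw [rayProfile_eq]
  linarith

/-- **KERNEL FACT (b): above the bracket the flux is ABOVE the level** (certified margin `1.33e-04`). [instance data] -/
theorem G_hi_pos {θ : ℝ} (h0 : (0 : ℝ) ≤ θ) (h1 : θ ≤ (1 / 40)) :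
    ((1 / 2) : ℝ) * U Xa 0 < PolarRay.rayProfile U Xa 0 θ ((12617 / 62500)) := by
  obtain ⟨e0, e1, -, -, e4, e5, -, -⟩ := panel_eq
  have hmem : pt θ ((12617 / 62500)) ∈ boxSet (castBox (boxAt rHi)) :=
    pt_mem ⟨by rw [e0]; push_cast; linarith, by rw [e1]; push_cast; linarith⟩ ⟨by rw [e4]; push_cast; linarith, by rw [e5]; push_cast; linarith⟩
  have h := eval_mem_of_mvExtLE cert_hi hmem
  rw [mem_ratCast_iff] at h
  have h1' := h.1
  push_cast at h1'
  rw [rayProfile_eq]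
  linarith

/-- **KERNEL FACT (c): the RADIAL DERIVATIVE along every ray of the panel is bracketed**,
`0.176753 ≤ ∂_ρ U(X_a + ρ cos θ, ρ sin θ) ≤ 0.221503` for `ρ ∈ [ρ_lo, ρ_hi]` (so `D_r > 0`). [instance data] -/
theorem hasDerivAt_rayProfile {θ s : ℝ} (h0 : (0 : ℝ) ≤ θ) (h1 : θ ≤ (1 / 40))
    (hs0 : ((2473 / 12500) : ℝ) ≤ s) (hs1 : s ≤ (12617 / 62500)) :
    HasDerivAt (PolarRay.rayProfile U Xa 0 θ) (dExpr.eval (pt θ s)) s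
      ∧ ((176753 / 1000000) : ℝ) ≤ dExpr.eval (pt θ s) ∧ dExpr.eval (pt θ s) ≤ (221503 / 1000000) := by
  obtain ⟨e0, e1, -, -, -, -, e6, e7⟩ := panel_eq
  have hmem : pt θ s ∈ boxSet (castBox (boxAt rSeg)) :=
    pt_mem ⟨by rw [e0]; push_cast; linarith, by rw [e1]; push_cast; linarith⟩ ⟨by rw [e6]; push_cast; linarith, by rw [e7]; push_cast; linarith⟩
  have hdom : gExpr.dom (Function.update (pt θ s) 10 s) := by
    rw [update_pt]; exact dom_of_evalBoxLE cert_dom hmem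
  have hd := hasDerivAt_eval_update 10 (pt θ s) gExpr hdom
  rw [update_pt] at hd
  have hfun : (fun r => gExpr.eval (Function.update (pt θ s) 10 r)) = fun r => PolarRay.rayProfile U Xa 0 θ r - ((1 / 2) : ℝ) * U Xa 0 := by
    funext r; rw [update_pt, rayProfile_eq]; ring
  rw [hfun] at hd
  have hd' := hd.add_const (((1 / 2) : ℝ) * U Xa 0)
  simp only [sub_add_cancel] at hd'
  have hr := eval_mem_of_mvExtLE cert_dr hmem
  rw [mem_ratCast_iff] at hr
  obtain ⟨hr1, hr2⟩ := hr
  push_cast at hr1 hr2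
  exact ⟨hd', hr1, hr2⟩

/-- **KERNEL FACT (d): ON EVERY RAY OF THE PANEL THE SURFACE `ψ_N = 1/2` IS MET EXACTLY ONCE IN THE BRACKET** —
`∃! ρ ∈ [ρ_lo, ρ_hi]` with `U(X_a + ρ cos θ, ρ sin θ) = (1 − ψ_N)·U(X_a, 0)` (PolarRay §3: sign change + positive radial derivative).
The per-panel ingredient of a polar-ray `q` certificate; nothing about `q` itself is claimed. [instance data] -/
theorem existsUnique_root {θ : ℝ} (h0 : (0 : ℝ) ≤ θ) (h1 : θ ≤ (1 / 40)) :
    ∃! ρ, ρ ∈ Icc ((2473 / 12500) : ℝ) ((12617 / 62500)) ∧ PolarRay.rayProfile U Xa 0 θ ρ = ((1 / 2) : ℝ) * U Xa 0 := by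
  have hcont : ContinuousOn (PolarRay.rayProfile U Xa 0 θ) (Icc ((2473 / 12500) : ℝ) ((12617 / 62500))) := by
    intro s hs
    exact (hasDerivAt_rayProfile h0 h1 hs.1 hs.2).1.continuousAt.continuousWithinAt
  have hmono : StrictMonoOn (PolarRay.rayProfile U Xa 0 θ) (Icc ((2473 / 12500) : ℝ) ((12617 / 62500))) := by
    apply PolarRay.strictMonoOn_rayProfile_of_deriv_pos hcont
    intro s hs
    have h := hasDerivAt_rayProfile h0 h1 hs.1.le hs.2.le
    rw [h.1.deriv]
    linarith [h.2.1]
  exact PolarRay.existsUnique_rayRoot (by norm_num) hcont hmono (G_lo_neg h0 h1) (G_hi_pos h0 h1)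

end PolarPanel

end Summit.Ventures.FusionMHD.Models.CFIterLike

end
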